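import Mathlib
import Summits.Ventures.HodgeRepro2.T5LocalUnitsProfinite

/-! # T5NormOneCompact — «E¹_v is compact»: the norm-one set of a local field is compact

Blind cell pub-hodge-repro2, seat p4 (Tier-5 kernel annex, README §7; record-class, cited by p-id
or ignored, never an input). README §8(d): uses an L-value-free non-vanishing device: NO.

The topological half of row E9 (F1) of N4.1 (route/T5-N4.1-route-1.md §N4.1.4: «E¹_v is compact
and equals its own maximal compact subgroup (norm-1 elements are units)») that `T5InertForcing`
(p394014) left to prose. On Mathlib's local-field object of `T5LocalUnitsProfinite` (p392345) —
`K` a complete ultrametric `NontriviallyNormedField` whose valuation ring `Valued.integer K` is a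
discrete valuation ring with finite residue field — and for a continuous, norm-preserving ring
endomorphism `σ` (the conjugation of `E_v/F_v`):
* `norm_eq_one_of_mul_conj_eq_one` : `z * σ z = 1 ⇒ ‖z‖ = 1` (the norm version of (F1));
* `exists_unit_of_mul_conj_eq_one` : a norm-one element is a unit of `Valued.integer K` (p392345's
  `range_val_eq`);
* `isClosed_normOne` : the norm-one set is closed (`σ` continuous);
* `isCompact_closedBall_one` : the unit ball `{z | ‖z‖ ≤ 1} = Valued.integer K` is compact
  (p392345's `compactSpace_integer`);
* `isCompact_normOne` : **the norm-one set is compact** — a closed subset of the compact unit ball.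
«Equals its own maximal compact subgroup» is then the tautology that a compact group is its own
maximal compact subgroup.

Stays prose: that `E_v` is such a field with `σ` the continuous norm-preserving conjugation, and
that `E¹_v = {z ∣ z σ(z) = 1}` is the group of the prose.
-/

namespace Summit.Ventures.HodgeRepro2.T5NormOneCompact

open Summit.Ventures.HodgeRepro2.T5LocalUnitsProfinite

section Norm

variable {K : Type*} [NormedField K]

/-- `z * σ z = 1` with `‖σ z‖ = ‖z‖` forces `‖z‖ = 1`. -/
theorem norm_eq_one_of_mul_conj_eq_one (σ : K →+* K) (hσ : ∀ z, ‖σ z‖ = ‖z‖) {z : K}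
    (h : z * σ z = 1) : ‖z‖ = 1 := by
  have h1 : ‖z‖ * ‖z‖ = 1 := by
    calc ‖z‖ * ‖z‖ = ‖z‖ * ‖σ z‖ := by rw [hσ z]
      _ = ‖z * σ z‖ := (norm_mul _ _).symm
      _ = 1 := by rw [h, norm_one]
  rcases mul_self_eq_one_iff.1 h1 with h2 | h2
  · exact h2
  · exact absurd (h2 ▸ norm_nonneg z) (by norm_num)

/-- The norm-one set `{z ∣ z * σ z = 1}` is closed when `σ` is continuous. -/
theorem isClosed_normOne (σ : K →+* K) (hσ : Continuous σ) :
    IsClosed {z : K | z * σ z = 1} :=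
  isClosed_eq (continuous_id.mul hσ) continuous_const

end Norm

section Compact

attribute [local instance] NormedField.toValued

variable {K : Type*} [NontriviallyNormedField K] [IsUltrametricDist K] [CompleteSpace K]
  [IsDiscreteValuationRing (Valued.integer K)] [Finite (Valued.ResidueField K)]

omit [CompleteSpace K] [IsDiscreteValuationRing (Valued.integer K)] [Finite (Valued.ResidueField K)] in
/-- A norm-one element `z * σ z = 1` is (the image of) a unit of the valuation ring
(`range_val_eq` of p392345: the units of `Valued.integer K` are its elements of norm one). -/
theorem exists_unit_of_mul_conj_eq_one (σ : K →+* K) (hσ : ∀ z, ‖σ z‖ = ‖z‖) {z : K}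
    (h : z * σ z = 1) : ∃ u : (Valued.integer K)ˣ, ((u : Valued.integer K) : K) = z := by
  have h1 : ‖z‖ = 1 := norm_eq_one_of_mul_conj_eq_one σ hσ h
  have hz : z ∈ Valued.integer K := by
    rw [Valuation.mem_integer_iff]
    exact (NNReal.coe_le_one (r := ‖z‖₊)).1 (by rw [coe_nnnorm, h1])
  have hmem : (⟨z, hz⟩ : Valued.integer K) ∈
      Set.range (Units.val : (Valued.integer K)ˣ → Valued.integer K) := by
    rw [range_val_eq]
    exact h1
  obtain ⟨u, hu⟩ := hmem
  exact ⟨u, by rw [hu]⟩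

/-- The unit ball `{z ∣ ‖z‖ ≤ 1}` is the valuation ring, hence compact (`compactSpace_integer`). -/
theorem isCompact_closedBall_one : IsCompact {z : K | ‖z‖ ≤ 1} := by
  haveI := compactSpace_integer (K := K)
  have h : {z : K | ‖z‖ ≤ 1} = Set.range (Subtype.val : Valued.integer K → K) := by
    ext z
    simp only [Set.mem_setOf_eq, Subtype.range_coe_subtype, Valuation.mem_integer_iff]
    exact (NNReal.coe_le_one (r := ‖z‖₊)).symm
  rw [h]
  exact isCompact_range continuous_subtype_val

/-- **«`E¹_v` is compact»**: the norm-one set of a continuous norm-preserving conjugation `σ` is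
compact — a closed subset of the compact unit ball. -/
theorem isCompact_normOne (σ : K →+* K) (hσc : Continuous σ) (hσ : ∀ z, ‖σ z‖ = ‖z‖) :
    IsCompact {z : K | z * σ z = 1} :=
  isCompact_closedBall_one.of_isClosed_subset (isClosed_normOne σ hσc)
    fun _ hz => (norm_eq_one_of_mul_conj_eq_one σ hσ hz).le

end Compact

end Summit.Ventures.HodgeRepro2.T5NormOneCompact
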